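import Mathlib
import Literature.Analysis.FluidPDE.SuitableWeak
import Literature.Analysis.FluidPDE.SelfSimilarCollapseAnsatz
import Summits.NavierStokesRegularity.NavierStokesRegularity.Theorems.EulerZoomLiouvillePowerGaugeEulerLiouvilleSelfSimilarGauges
import HarnessLib

/-!
# Crux E `PowerGaugeEulerLiouville` (stmt-NavierStokesRegularity-19832): the FAST-INFLOW NEEDLES of a self-similar profile are thin

Route `EulerZoomLiouville` (NavierStokesRegularity), crux E.  Quantitative portrait for THE ONE STATEMENT of the
lead skeleton `Cruxes/PowerGaugeEulerLiouville/Lines/birth.lean` (`stub_selfSimilarC2Needle`, registered since v27;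
RESIDUE-MEMO-19832-g9-addendum §B).  For an exactly self-similar member of Seregin's class the profile's `A`-gauge
reads `∫_{B_L} |V|² ≤ c L^{1−2ρ}` (`profile_energy_growth_of_gaugeA`).  On the FAST-INFLOW SET
`F_κ = {y : ⟪y, V(y)⟫ < −κ‖y‖²}` (`κ > 0`) Cauchy–Schwarz gives `‖V(y)‖ ≥ κ‖y‖`, so by Chebyshev the part of
`F_κ` in the shell `L ≤ ‖y‖ < 2L` has VOLUME `≤ c (2L)^{1−2ρ}/(κ² L²) = c 2^{1−2ρ} κ^{−2} L^{−1−2ρ}`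
(`Needle.volume_fastInflow_shell_le_of_growth`, `Needle.volume_fastInflow_shell_le_of_gaugeA`): the fast-inflow set, which by
ns-typeII-p1 g8's portraits (`…SelfSimilarVorticalEscape`, `…SelfSimilarInflowVisits`) every vortical backward
similarity orbit must visit beyond every radius, is a union of radially thin NEEDLES whose volume in dyadic
shells decays like `L^{−1−2ρ}` while the shells grow like `L³` — the number a new lever has to beat.
WHAT THIS IS NOT: not NS regularity, not the crux `E` — a measure-theoretic portrait (Chebyshev), no PDE.
-/

noncomputable section

set_option linter.dupNamespace false

open MeasureTheory Set Filter Topology Metric Function TopologicalSpace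
open scoped ENNReal NNReal RealInnerProductSpace

namespace Summit.NavierStokesRegularity.NavierStokesRegularity.Theorems.PowerGaugeEulerLiouville.Needle

open Literature.Analysis Literature.Analysis.FluidPDE

/-- **On the fast-inflow set the speed is at least `κ‖y‖`**: `⟪y, V y⟫ < −κ‖y‖²` gives `κ‖y‖ ≤ ‖V y‖`
(Cauchy–Schwarz). [folklore] -/
theorem norm_ge_of_fastInflow {V : EuclideanSpace ℝ (Fin 3) → EuclideanSpace ℝ (Fin 3)} {κ : ℝ}
    {y : EuclideanSpace ℝ (Fin 3)} (hy : ⟪y, V y⟫ < -(κ * ‖y‖ ^ 2)) : κ * ‖y‖ ≤ ‖V y‖ := by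
  have h1 : κ * ‖y‖ ^ 2 < ‖y‖ * ‖V y‖ := by
    have h2 : |⟪y, V y⟫| ≤ ‖y‖ * ‖V y‖ := abs_real_inner_le_norm y (V y)
    have h3 : -(‖y‖ * ‖V y‖) ≤ ⟪y, V y⟫ := by
      have := neg_abs_le ⟪y, V y⟫
      linarith
    linarith
  by_cases hy0 : ‖y‖ = 0
  · rw [hy0]; simp
  · have hypos : 0 < ‖y‖ := lt_of_le_of_ne (norm_nonneg _) (Ne.symm hy0)
    have : κ * ‖y‖ * ‖y‖ < ‖V y‖ * ‖y‖ := by nlinarith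
    exact le_of_lt (lt_of_mul_lt_mul_right this hypos.le)

/-- **The fast-inflow needles are thin (growth form).**  If `∫_{B_{2L}} |V|² ≤ C (2L)^θ` and `κ > 0`, `L > 0`, then the
part of the fast-inflow set `{y : ⟪y, V y⟫ < −κ‖y‖²}` in the shell `L ≤ ‖y‖ < 2L` has volume
`≤ C (2L)^θ / (κ L)²` (Chebyshev with `‖V‖ ≥ κ L` there). [folklore] -/
theorem volume_fastInflow_shell_le_of_growth {V : EuclideanSpace ℝ (Fin 3) → EuclideanSpace ℝ (Fin 3)}
    (hVm : AEStronglyMeasurable V volume) {C : ℝ≥0∞} {θ κ L : ℝ} (hκ : 0 < κ) (hL : 0 < L)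
    (hA : ∫⁻ y in ball (0 : EuclideanSpace ℝ (Fin 3)) (2 * L), ‖V y‖ₑ ^ 2 ≤ C * ENNReal.ofReal ((2 * L) ^ θ)) :
    volume ({y : EuclideanSpace ℝ (Fin 3) | ⟪y, V y⟫ < -(κ * ‖y‖ ^ 2)} ∩
        (ball (0 : EuclideanSpace ℝ (Fin 3)) (2 * L) \ ball (0 : EuclideanSpace ℝ (Fin 3)) L)) ≤
      C * ENNReal.ofReal ((2 * L) ^ θ) / ENNReal.ofReal ((κ * L) ^ 2) := by
  set A : Set (EuclideanSpace ℝ (Fin 3)) :=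
    ball (0 : EuclideanSpace ℝ (Fin 3)) (2 * L) \ ball (0 : EuclideanSpace ℝ (Fin 3)) L with hAdef
  have hAm : MeasurableSet A := measurableSet_ball.diff measurableSet_ball
  set S : Set (EuclideanSpace ℝ (Fin 3)) := {y | ⟪y, V y⟫ < -(κ * ‖y‖ ^ 2)} ∩ A with hS
  have hκL : 0 < (κ * L) ^ 2 := by positivity
  -- on `S`: `‖V y‖ₑ² ≥ (κ L)²`
  have hlow : ∀ y ∈ S, ENNReal.ofReal ((κ * L) ^ 2) ≤ ‖V y‖ₑ ^ 2 := by
    intro y hy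
    have hy1 : ⟪y, V y⟫ < -(κ * ‖y‖ ^ 2) := hy.1
    have hyL : L ≤ ‖y‖ := by
      have h := hy.2.2
      rw [mem_ball_zero_iff, not_lt] at h
      exact h
    have h1 : κ * ‖y‖ ≤ ‖V y‖ := norm_ge_of_fastInflow hy1
    have h2 : κ * L ≤ ‖V y‖ := le_trans (by nlinarith) h1
    calc ENNReal.ofReal ((κ * L) ^ 2) ≤ ENNReal.ofReal (‖V y‖ ^ 2) := by
          apply ENNReal.ofReal_le_ofReal
          have : 0 ≤ κ * L := by positivity
          nlinarith [norm_nonneg (V y)]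
      _ = ‖V y‖ₑ ^ 2 := by
          rw [← ofReal_norm, ← ENNReal.ofReal_pow (norm_nonneg _)]
  -- Chebyshev on the shell
  have hf : AEMeasurable (fun y => ‖V y‖ₑ ^ 2) (volume.restrict A) :=
    (hVm.restrict.aemeasurable.enorm.pow_const 2)
  have hM := mul_meas_ge_le_lintegral₀ hf (ENNReal.ofReal ((κ * L) ^ 2))
  have h1 : volume S ≤ (volume.restrict A) {y | ENNReal.ofReal ((κ * L) ^ 2) ≤ ‖V y‖ₑ ^ 2} := by
    rw [Measure.restrict_apply' hAm]
    exact measure_mono fun y hy => ⟨hlow y hy, hy.2⟩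
  have h2 : ∫⁻ y in A, ‖V y‖ₑ ^ 2 ≤ ∫⁻ y in ball (0 : EuclideanSpace ℝ (Fin 3)) (2 * L), ‖V y‖ₑ ^ 2 :=
    lintegral_mono_set fun y hy => hy.1
  have h3 : volume S * ENNReal.ofReal ((κ * L) ^ 2) ≤ C * ENNReal.ofReal ((2 * L) ^ θ) :=
    calc volume S * ENNReal.ofReal ((κ * L) ^ 2)
        ≤ (volume.restrict A) {y | ENNReal.ofReal ((κ * L) ^ 2) ≤ ‖V y‖ₑ ^ 2} * ENNReal.ofReal ((κ * L) ^ 2) := by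
          gcongr
      _ = ENNReal.ofReal ((κ * L) ^ 2) * (volume.restrict A) {y | ENNReal.ofReal ((κ * L) ^ 2) ≤ ‖V y‖ₑ ^ 2} :=
          mul_comm _ _
      _ ≤ ∫⁻ y in A, ‖V y‖ₑ ^ 2 := hM
      _ ≤ _ := h2.trans hA
  exact (ENNReal.le_div_iff_mul_le (Or.inl (ENNReal.ofReal_pos.2 hκL).ne') (Or.inl ENNReal.ofReal_ne_top)).2 h3

/-- **The fast-inflow needles of a gauged self-similar profile are thin.**  For an exactly self-similar member of the
power-gauged class (`u(τ) = (−τ)^{γ−1} V((−τ)^{−γ}·)`, `γ = 1/(2+ρ)`, `a^{2ρ} A(a) ≤ c`) with measurable profile `V`,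
the fast-inflow set `{⟪y, V y⟫ < −κ‖y‖²}` meets the shell `L ≤ ‖y‖ < 2L` in volume
`≤ c (2L)^{1−2ρ} / (κL)² = c 2^{1−2ρ} κ^{−2} L^{−1−2ρ}` — summable over dyadic shells, although by ns-typeII-p1 g8's portraits
every vortical backward similarity orbit visits this set beyond every radius (THE ONE STATEMENT `stub_selfSimilarC2Needle`). [folklore] -/
theorem volume_fastInflow_shell_le_of_gaugeA {ρ : ℝ} (hρ : 0 < ρ)
    {u : ℝ → EuclideanSpace ℝ (Fin 3) → EuclideanSpace ℝ (Fin 3)}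
    {V : EuclideanSpace ℝ (Fin 3) → EuclideanSpace ℝ (Fin 3)} {c : ℝ≥0}
    (hu : ∀ τ : ℝ, τ < 0 → u τ = selfSimilarCollapse (1 / (2 + ρ)) 0 V τ)
    (hA : ∀ a : ℝ, 0 < a → ENNReal.ofReal (a ^ (2 * ρ)) *
      cknA a (0 : ℝ × EuclideanSpace ℝ (Fin 3)) u ≤ (c : ℝ≥0∞))
    (hVm : AEStronglyMeasurable V volume) {κ L : ℝ} (hκ : 0 < κ) (hL : 0 < L) :
    volume ({y : EuclideanSpace ℝ (Fin 3) | ⟪y, V y⟫ < -(κ * ‖y‖ ^ 2)} ∩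
        (ball (0 : EuclideanSpace ℝ (Fin 3)) (2 * L) \ ball (0 : EuclideanSpace ℝ (Fin 3)) L)) ≤
      (c : ℝ≥0∞) * ENNReal.ofReal ((2 * L) ^ (1 - 2 * ρ)) / ENNReal.ofReal ((κ * L) ^ 2) :=
  volume_fastInflow_shell_le_of_growth hVm hκ hL (profile_energy_growth_of_gaugeA hρ hu hA (2 * L) (by positivity))

end Summit.NavierStokesRegularity.NavierStokesRegularity.Theorems.PowerGaugeEulerLiouville.Needle
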